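import Mathlib
import Literature.AlgebraicGeometry.Motives.CrystallineRealization
import Literature.AlgebraicGeometry.Resolution.ChowLemmaRing
import Literature.AlgebraicGeometry.Morphisms.DevissageClass
import Summits.HodgeConjecture.HodgeConjecture.Theses.PadicSemiregularLift

/-!
# Crux FormalVectorBundlesAlgebraize (stmt-HodgeConjecture-14106) — ideator 2 sketch (round 1)

First lemmas of two crux-idea cards, typed over existing declarations only:

* card `flat-tower-uniform-serre` (lever L1, the PROJECTIVE ENGINE): `ProjectiveFlatEngine`,
  `ProjectiveFlatEngineStrong`;
* card `chow-zariski-pushforward` (lever L2, PROPER from projective by pushing forward along a Chow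
  cover of the smooth — hence normal — model): `ChowCoverFunctions`, `PushforwardTransport`;
* shared finishing lemma `FormallyLocallyFreeIsLocallyFree` (Görtz–Wedhorn II Prop 24.95 / Lemma 24.96).

Nothing here is proved; these are `Prop`-valued statements that must elaborate (crux-ideate stage).
-/

noncomputable section

open CategoryTheory AlgebraicGeometry
open Literature.AlgebraicGeometry.Motives Literature.AlgebraicGeometry.Motives.WittScheme
open Literature.AlgebraicGeometry.Resolution

namespace Summit.HodgeConjecture.HodgeConjecture.Cruxes.FormalVectorBundlesAlgebraize.IdeatorTwo

universe u

section Thickenings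

variable {p : ℕ} [Fact p.Prime] {k : Type} [Field k] [CharP k p]

/-- The map of `n`-th thickenings `X'_n ⟶ X_n` induced by a `W`-morphism `ρ : 𝒳' ⟶ 𝒳`
(base change of `ρ` along `W → W/pⁿ`). -/
def thickeningMapOver {𝒳' 𝒳 : SchemeOver (WittVector p k)} (ρ : 𝒳' ⟶ 𝒳) (n : ℕ) :
    thickening 𝒳' n ⟶ thickening 𝒳 n :=
  (baseChange (WittVector p k) (wittQuot p k n)).map ρ

end Thickenings

/-- **L1 — the projective engine (crux shape).** For `Z` a CLOSED `W`-subscheme of some `ℙᴺ_W`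
(`ChowLemmaRing.IsProjOver`) that is FLAT over `W = W(k)` (no smoothness, no reducedness of the
special fibre), every module on the special fibre that lifts formally lifts algebraically.
Lever: flatness makes the graded pieces `pⁿ𝒪_Z/pⁿ⁺¹𝒪_Z ≅ 𝒪_{Z_k}` CONSTANT, so the Rees module of a
formal vector bundle `(F_n)` is `F_0[t]` and ONE Serre bound `m₀(F_0)` on the projective `k`-scheme
`Z_k` lifts generators/relations through the whole tower; only the `H⁰`-comparison (theorem on formal
functions for `𝒪_Z(j)`) is needed to algebraize the presentation matrix. -/
def ProjectiveFlatEngine : Prop :=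
  ∀ (p : ℕ) [Fact p.Prime] (k : Type) [Field k] [CharP k p] [PerfectRing k p]
    (Z : SchemeOver (WittVector p k)), ChowLemmaRing.IsProjOver Z → Flat Z.hom →
    ∀ (E₁ : (specialFibre Z).left.Modules), LiftsFormally Z E₁ → LiftsTo Z E₁

/-- **L1, strong form (algebraizes the GIVEN tower, level-wise).** Same hypotheses; the output vector
bundle `E` on `Z` restricts on EVERY thickening `Z_{n+1}` to the given `F n`. (Level-wise `Nonempty`
isomorphisms can always be re-chosen compatibly with the transition isomorphisms: the tower of finite
`W_{n+1}`-algebras `End(F n)` is Mittag-Leffler, so `lim¹ Aut(F n)` vanishes — see the card.) -/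
def ProjectiveFlatEngineStrong : Prop :=
  ∀ (p : ℕ) [Fact p.Prime] (k : Type) [Field k] [CharP k p] [PerfectRing k p]
    (Z : SchemeOver (WittVector p k)), ChowLemmaRing.IsProjOver Z → Flat Z.hom →
    ∀ (F : ∀ n : ℕ, (thickening Z (n + 1)).left.Modules), (∀ n, IsVectorBundle (F n)) →
      (∀ n, Nonempty ((Scheme.Modules.pullback (thickeningMap Z (Nat.le_succ (n + 1)))).obj (F (n + 1))
        ≅ F n)) →
      ∃ E : Z.left.Modules, IsVectorBundle E ∧
        ∀ n, Nonempty ((Scheme.Modules.pullback (thickeningι Z (n + 1))).obj E ≅ F n)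

/-- **L2 (a) — Zariski–Hartogs on the smooth model.** For a Chow cover `ρ : X' ⟶ 𝒳` (integral
source, proper, surjective, an isomorphism over a dense open) of a smooth proper model `𝒳/W(k)`,
pulling back functions is bijective on every open: `ρ_* 𝒪_{X'} = 𝒪_𝒳`. This is where the crux's
SMOOTHNESS is consumed (local rings of `𝒳` regular ⇒ factorial ⇒ algebraic Hartogs,
tree `Motives/RatFnBirationalHartogs`), replacing Zariski's Main Theorem / normality. -/
def ChowCoverFunctions : Prop :=
  ∀ (p : ℕ) [Fact p.Prime] (k : Type) [Field k] [CharP k p] [PerfectRing k p] (d : ℕ)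
    (𝒳 : SchemeOver (WittVector p k)), IsSmoothProperModel d 𝒳 →
    ∀ (X' : Scheme.{0}) (ρ : X' ⟶ 𝒳.left), IsIntegral X' → IsProper ρ → Surjective ρ →
      (∃ U : 𝒳.left.Opens, Dense (U : Set 𝒳.left) ∧ IsIso (ρ ∣_ U)) →
      ∀ U : 𝒳.left.Opens, Function.Bijective (ρ.app U)

/-- **L2 (b) — pushforward transport (the lever).** `𝒳/W` a smooth proper model, `ρ : 𝒳' ⟶ 𝒳` a
proper `W`-morphism with `ρ_*𝒪 = 𝒪` from a `W`-projective, `W`-flat `𝒳'` (a Chow cover), `(E n)` a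
formal vector bundle on `𝒳` and `E'` a vector bundle on `𝒳'` restricting on each thickening `X'_{n+1}`
to the pulled-back level `ρ_{n+1}^* E n`. THEN `ρ_* E'` is a vector bundle on `𝒳` restricting to `E n`
on every `X_{n+1}`. Proof idea (no dévissage, no abelian category of formal modules, no Ext
comparison): projection formula `ρ_{n*}ρ_n^* E_n = E_n ⊗ ρ_{n*}𝒪_{X'_n}`; the theorem on formal
functions for `H⁰` along `ρ` in its pro form (cokernels of `𝒪_{X_n} → ρ_{n*}𝒪_{X'_n}` and of
`(ρ_*E')/pⁿ⁺¹ → ρ_*(E'/pⁿ⁺¹)` are killed from a FIXED number `c` of levels up, `c` = exponent of the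
`p^∞`-torsion of the finite modules `Ȟ¹`, tree `Morphisms/DevissageHeart` finiteness on proper schemes);
a pro-isomorphism between ADIC systems is a level-wise isomorphism; finish with
`FormallyLocallyFreeIsLocallyFree`. -/
def PushforwardTransport : Prop :=
  ∀ (p : ℕ) [Fact p.Prime] (k : Type) [Field k] [CharP k p] [PerfectRing k p] (d : ℕ)
    (𝒳 : SchemeOver (WittVector p k)), IsSmoothProperModel d 𝒳 →
    ∀ (𝒳' : SchemeOver (WittVector p k)) (ρ : 𝒳' ⟶ 𝒳), IsProper ρ.left →
      (∀ U : 𝒳.left.Opens, Function.Bijective (ρ.left.app U)) →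
      ChowLemmaRing.IsProjOver 𝒳' → Flat 𝒳'.hom →
      ∀ (E : ∀ n : ℕ, (thickening 𝒳 (n + 1)).left.Modules), (∀ n, IsVectorBundle (E n)) →
        (∀ n, Nonempty ((Scheme.Modules.pullback (thickeningMap 𝒳 (Nat.le_succ (n + 1)))).obj
          (E (n + 1)) ≅ E n)) →
        ∀ (E' : 𝒳'.left.Modules), IsVectorBundle E' →
          (∀ n, Nonempty ((Scheme.Modules.pullback (thickeningι 𝒳' (n + 1))).obj E' ≅
            (Scheme.Modules.pullback (thickeningMapOver ρ (n + 1)).left).obj (E n))) →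
          IsVectorBundle ((Scheme.Modules.pushforward ρ.left).obj E') ∧
            ∀ n, Nonempty ((Scheme.Modules.pullback (thickeningι 𝒳 (n + 1))).obj
              ((Scheme.Modules.pushforward ρ.left).obj E') ≅ E n)

/-- **Shared finishing lemma** (Görtz–Wedhorn II, Prop 24.95 + Lemma 24.96, in elementary form): a
COHERENT module on a smooth proper model all of whose restrictions to the thickenings `X_{n+1}` are
vector bundles is a vector bundle — stalkwise at points of `X_k` by Krull's intersection theorem
(Mathlib `Ideal.iInf_pow_smul_eq_bot_of_isLocalRing`), then everywhere because the free locus is open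
(Mathlib `Module.isOpen_freeLocus`) and `𝒳 → Spec W` is closed (every open neighbourhood of `X_k` is
`𝒳`). `Coh` is the tree's affine-local coherence (`Morphisms/DevissageClass`). -/
def FormallyLocallyFreeIsLocallyFree : Prop :=
  ∀ (p : ℕ) [Fact p.Prime] (k : Type) [Field k] [CharP k p] [PerfectRing k p] (d : ℕ)
    (𝒳 : SchemeOver (WittVector p k)), IsSmoothProperModel d 𝒳 →
    ∀ (E : 𝒳.left.Modules), Literature.AlgebraicGeometry.Morphisms.Coh E →
      (∀ n, IsVectorBundle ((Scheme.Modules.pullback (thickeningι 𝒳 (n + 1))).obj E)) →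
      IsVectorBundle E

section Glue

variable {p : ℕ} [Fact p.Prime] {k : Type} [Field k] [CharP k p]

/-- **Last glue step (proved):** a vector bundle `G` on `𝒳` whose restriction to the first
thickening `X_1` is (isomorphic to) the level-`0` sheaf `E 0` of a formal lift of `E₁` witnesses
`LiftsTo 𝒳 E₁` — restriction to `X_k` factors through `X_1` (`specialFibreToThickening_ι`). This is how
the conclusion of `PushforwardTransport` (or of `ProjectiveFlatEngineStrong`) closes the crux. -/
theorem liftsTo_of_levelOne (𝒳 : SchemeOver (WittVector p k)) (G : 𝒳.left.Modules)
    (hG : IsVectorBundle G) (E₁ : (specialFibre 𝒳).left.Modules)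
    (E0 : (thickening 𝒳 1).left.Modules)
    (e : (Scheme.Modules.pullback (thickeningι 𝒳 1)).obj G ≅ E0)
    (e₀ : (Scheme.Modules.pullback (specialFibreToThickening 𝒳 0)).obj E0 ≅ E₁) :
    LiftsTo 𝒳 E₁ :=
  ⟨G, hG, ⟨(Scheme.Modules.pullbackCongr (specialFibreToThickening_ι 𝒳 0).symm).app G ≪≫
      ((Scheme.Modules.pullbackComp (specialFibreToThickening 𝒳 0) (thickeningι 𝒳 1)).app G).symm ≪≫
      (Scheme.Modules.pullback (specialFibreToThickening 𝒳 0)).mapIso e ≪≫ e₀⟩⟩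

end Glue

/-- Sanity: the crux decl is in scope under its route name (the composition itself is crux-plan's job). -/
example : Prop := Summit.HodgeConjecture.HodgeConjecture.Theses.PadicSemiregularLift.FormalVectorBundlesAlgebraize

end Summit.HodgeConjecture.HodgeConjecture.Cruxes.FormalVectorBundlesAlgebraize.IdeatorTwo

end
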